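import Summits.NavierStokesRegularity.NavierStokesRegularity.Theses.ExtremalTypeIConstant
import Summits.NavierStokesRegularity.NavierStokesRegularity.Theorems.SymmetryModuliCountSymmetricLiouvilleCore
import Summits.NavierStokesRegularity.NavierStokesRegularity.Theorems.ExtremalTypeIConstantSpiralScalingLiouvilleStubRssProfileSystem
import Summits.NavierStokesRegularity.NavierStokesRegularity.Theorems.ExtremalTypeIConstantSpiralScalingLiouvilleStubRateZero
import Summits.NavierStokesRegularity.NavierStokesRegularity.Theorems.ExtremalTypeIConstantSpiralScalingLiouvilleStubProfileAxisNormalForm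
import Summits.NavierStokesRegularity.NavierStokesRegularity.Theorems.ExtremalTypeIConstantSpiralScalingLiouvilleStubPvClassOfProfile
import Summits.NavierStokesRegularity.NavierStokesRegularity.Theorems.TypeICertificateLadderTargetSolitonReduction
import Literature.Analysis.FluidPDE.TypeIAncientMild
import Literature.Analysis.FluidPDE.TypeIAncientMildClassical
import Literature.Analysis.FluidPDE.PineauVicolRSS
import HarnessLib

/-!
# Birth skeleton (BC3) of crux `SpiralScalingLiouville` (stmt-NavierStokesRegularity-8216, rank 3,
# route `ExtremalTypeIConstant`): the ROTATED LERAY PROFILE SYSTEM and its Liouville theorem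

Crux (by name, `Summit.NavierStokesRegularity.NavierStokesRegularity.Theses.ExtremalTypeIConstant.SpiralScalingLiouville`):
an element `u` of the Type-I KNSS-mild ancient class `A_C` on `ℝ³` (jointly smooth on `t < 0`, divergence free,
Oseen-mild between all pairs of negative times, `‖u(t,x)‖ ≤ C/√(−t)`) which is annihilated on `t < 0` by a
spiral-scaling generator `∇u·(a + x + Ax) + u + 2t∂ₜu − Au`, `A` skew, vanishes identically on `t < 0`.

## The line (two registered stubs, everything else is the tree)

Write `c` for the spiral CENTRE (`c + Ac = −a`; `1 + A` is invertible for skew `A`, tree: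
`exists_spiral_centre`) and `v(t, y) = u(t, y + c) ∈ A_C` (tree: `isTypeIAncientMild_comp_add_right`), which is
annihilated by the generator in normal form `∇v·(y + Ay) + v + 2t∂ₜv − Av` (chain rule, proved below).

* **Tree, not a stub — Pineau–Vicol decay.** `v` lies in Pineau–Vicol's class (1.10),
  `‖v(t,y)‖ ≤ K/(‖y‖ + √(−t))` (`rssFarFieldTypeIDecay` = far-field recentring `rssFarFieldVanishing` + the
  symmetry-free Oseen bootstrap B2 `oseenBootstrap`, both landed for the sibling crux stmt-4053).
* **Stub 1 `stub_rssProfileSystem` (M, provable now) — the rotated Leray profile system in the gauge.** The profile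
  `U = v(−1, ·)` solves, with the KNSS pressure slice `P = p(−1, ·) ∈ C¹`
  (`IsTypeIAncientMild.exists_isClassicalNSSolutionOn_Ioo`; interior `timeDerivWithin = timeDeriv`; the generator
  supplies `∂ₜv(−1, y) = ½(∇U·(y + Ay) + U − AU)`), Pineau–Vicol's profile system (1.8) written with the matrix `A`:
  `−ΔU + ½U + ½∇U·(y + Ay) − ½AU + (U·∇)U + ∇P = 0` (for `A = 0`: `IsLerayProfile 1 ½ U P`, Leray 1934 (3.12)).
* **Stub 2 `stub_rotatedProfileLiouville` (XL, the OPEN CORE in its canonical profile form) — Liouville for the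
  rotated Leray profile system in the Type-I decay class.** A smooth divergence-free solution `(U, P)` of that system
  with `A` skew and `‖U(y)‖ ≤ K/(‖y‖ + 1)` vanishes. `A = 0`: Tsai 1998 Thm 1 with `q = 4` (`U ∈ L⁴`; in tree).
  `A ≠ 0`: Pineau–Vicol 2026 Conjecture 1.1 = Tsai GSM 192 Conj. 8.9 = Bradshaw–Tsai 2017 OP 5.2; KNOWN for
  `|α| < α₁(K)` and `|α| > α₂(K)` (PV Thm 1.4, in tree as `pineauVicol2026_rss_liouville_holds`, reachable through the
  profile → ansatz bridge), OPEN on the window `α ≈ 1`. The decay hypothesis is load-bearing: without it every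
  decaying-at-no-rate harmonic gradient `U = ∇φ` (with `P = −|U|²/2 − ½(y + Ay)·∇φ`) is a parasitic solution — this is
  the profile-side image of the sibling disproof `Negative.rssLiouvilleOfFarField_false_without_mild` (crux stmt-4053).
* **Assembly `SpiralScalingLiouville_of` (real proof):** unfold the class (`isTypeIAncientMild_iff`), centre and
  translate, PV decay (tree), stub 1, stub 2 ⇒ `v(−1, ·) = 0`, and the integrated spiral scaling
  `v(s, y) = e^ρ e^{−ρA} v(e^{2ρ}s, e^ρ e^{ρA} y)` (tree: `rss_identity_of_generator`) with `e^ρ = (−s)^{-1/2}` transports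
  the vanishing slice to every `s < 0`; translate back.

RESHAPE (lead c1, 2026-08-17). Stub 1 is LANDED (p146308). Stub 2 is now DERIVED (`rotatedProfileLiouville_of`)
from four registered stubs: **2a** `stub_rotatedProfileLiouvilleRateZero` (`A = 0`: Tsai 1998 Thm 1 at `q = ∞` +
decay; S), **2b** `stub_profileAxisNormalForm` (`A ≠ 0`: conjugate by a linear isometry to Pineau–Vicol's form (1.8a),
`A ↦ −2αJ`, pressure upgraded to `C^∞`; M), **2c** `stub_pvClassOfProfile` (profile ⇒ classical Type-I RSS solution
of Pineau–Vicol's class on `[−1,0)` through the ansatz (1.7); M), **2d** `stub_windowLiouville` — VERBATIM the open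
window stub B5b of crux `Target` (stmt-1217): by the tree (`rssLiouville_of_windowLiouville` = PV Thm 1.4 off the
window + the landed conjugate density / soliton laws / gap lemma for `4α² ≤ ε₀`) it gives Liouville for ALL rates in
Pineau–Vicol's class. 2a–2c are LANDED (2a p150931, 2b p149847, 2c p149921, wave 2 of lead c1); 2d is the single remaining `sorry`
and the single piece of OPEN MATHEMATICS, shared verbatim with
stmt-1217 and equivalent (tree: `solitonBridge_windowLiouville_iff_symmetricLiouville`,
`spiralScalingLiouville_iff_symmetricLiouville`) to stmt-4053 and to this crux.

Position: the crux implies stub 2 only through the (unformalised, M/L) converse bridge profile → Oseen-mild ancient RSS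
field; stub 2 implies the crux only through stub 1 + B2 + far-field recentring + the RSS identity. Neither stub is the
crux or the summit up to `exact? | simpa | aesop` (BC3 probes in the registrar's folder `bc/`).

References: Pineau–Vicol arXiv:2607.09619 (1.7)–(1.10), Conj. 1.1, Thm 1.4; Tsai, ARMA 143 (1998) Thm 1;
Koch–Nadirashvili–Seregin–Šverák, Acta Math. 203 (2009) = arXiv:0709.3599 §4, §6; Bradshaw–Tsai, CPDE 42 (2017) §5;
Tsai, GSM 192 (2018) Conj. 8.9; Leray, Acta Math. 63 (1934) (3.12).
-/

noncomputable section

set_option linter.dupNamespace false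

open Set Function
open scoped ContDiff Laplacian
open Literature.Analysis.FluidPDE
open Summit.NavierStokesRegularity.NavierStokesRegularity.Theorems.SymmetryModuliCountSymmetricLiouville

namespace Summit.NavierStokesRegularity.NavierStokesRegularity.Cruxes.SpiralScalingLiouville.Birth

/-- Local notation for physical space `ℝ³`. -/
local notation "E3" => EuclideanSpace ℝ (Fin 3)

/-! ## Statements of the stubs (`Sig.*`, sorry-free `def`s; the composition takes them BY NAME) -/

/-- Statement of stub 1 `stub_rssProfileSystem`: the rotated Leray profile system at `t = −1` for an element of
`A_C` annihilated by the spiral-scaling generator in normal form. -/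
def Sig.stub_rssProfileSystem : Prop :=
  ∀ (C : ℝ) (u : ℝ → E3 → E3), IsTypeIAncientMild C u →
    ∀ A : E3 →L[ℝ] E3,
      (∀ t < 0, ∀ x, fderiv ℝ (u t) x (x + A x) + u t x + (2 * t) • timeDeriv u t x - A (u t x) = 0) →
      ∃ P : E3 → ℝ, ContDiff ℝ 1 P ∧
        ∀ y, -((Δ (u (-1))) y) + (1 / 2 : ℝ) • u (-1) y + (1 / 2 : ℝ) • fderiv ℝ (u (-1)) y (y + A y)
          - (1 / 2 : ℝ) • A (u (-1) y) + convect (u (-1)) (u (-1)) y + gradient P y = 0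

/-- Statement of stub 2 `stub_rotatedProfileLiouville`: Liouville for the rotated Leray profile system in the
Type-I decay class (Pineau–Vicol Conj. 1.1 in profile form; Tsai 1998 for `A = 0`). -/
def Sig.stub_rotatedProfileLiouville : Prop :=
  ∀ (A : E3 →L[ℝ] E3), (∀ x, inner ℝ (A x) x = 0) →
    ∀ (U : E3 → E3) (P : E3 → ℝ), ContDiff ℝ ∞ U → ContDiff ℝ 1 P →
      VectorCalculus.IsDivFree U →
      (∀ y, -((Δ U) y) + (1 / 2 : ℝ) • U y + (1 / 2 : ℝ) • fderiv ℝ U y (y + A y)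
          - (1 / 2 : ℝ) • A (U y) + convect U U y + gradient P y = 0) →
      (∃ K : ℝ, ∀ y, ‖U y‖ ≤ K / (‖y‖ + 1)) →
      U = 0

/-- Statement of stub 2a `stub_rotatedProfileLiouvilleRateZero`: the case `A = 0` of stub 2 (Leray's profile equation
with `ν = 1`, `a = ½`; Tsai 1998 Thm 1 at `q = ∞` plus the decay). -/
def Sig.stub_rotatedProfileLiouvilleRateZero : Prop :=
  ∀ (U : E3 → E3) (P : E3 → ℝ), ContDiff ℝ ∞ U → ContDiff ℝ 1 P →
    VectorCalculus.IsDivFree U →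
    (∀ y, -((Δ U) y) + (1 / 2 : ℝ) • U y + (1 / 2 : ℝ) • fderiv ℝ U y y + convect U U y + gradient P y = 0) →
    (∃ K : ℝ, ∀ y, ‖U y‖ ≤ K / (‖y‖ + 1)) →
    U = 0

/-- Statement of stub 2b `stub_profileAxisNormalForm`: for `A ≠ 0`, conjugation by a linear isometry of `ℝ³` puts a
solution of the rotated profile system into Pineau–Vicol's form (1.8a) (`A ↦ −2αJ`, `J = rotGen`, `α ≠ 0`), with a
smooth pressure and the same decay constant. -/
def Sig.stub_profileAxisNormalForm : Prop :=
  ∀ (A : E3 →L[ℝ] E3), (∀ x, inner ℝ (A x) x = 0) → A ≠ 0 →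
    ∀ (U : E3 → E3) (P : E3 → ℝ), ContDiff ℝ ∞ U → ContDiff ℝ 1 P →
      VectorCalculus.IsDivFree U →
      (∀ y, -((Δ U) y) + (1 / 2 : ℝ) • U y + (1 / 2 : ℝ) • fderiv ℝ U y (y + A y)
          - (1 / 2 : ℝ) • A (U y) + convect U U y + gradient P y = 0) →
      ∀ K : ℝ, (∀ y, ‖U y‖ ≤ K / (‖y‖ + 1)) →
      ∃ (L : E3 ≃ₗᵢ[ℝ] E3) (α : ℝ) (V : E3 → E3) (Q : E3 → ℝ), α ≠ 0 ∧ ContDiff ℝ ∞ V ∧ ContDiff ℝ ∞ Q ∧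
        VectorCalculus.IsDivFree V ∧
        (∀ y, α • (rotGen (V y) - fderiv ℝ V y (rotGen y)) + (1 / 2 : ℝ) • V y + (1 / 2 : ℝ) • fderiv ℝ V y y
            - (Δ V) y + fderiv ℝ V y (V y) + gradient Q y = 0) ∧
        (∀ y, ‖V y‖ ≤ K / (‖y‖ + 1)) ∧ (∀ y, V y = L (U (L.symm y)))

/-- Statement of stub 2c `stub_pvClassOfProfile`: a smooth solution of Pineau–Vicol's profile system (1.8a) with the
Type-I profile decay generates, through the ansatz (1.7), a classical Navier–Stokes solution on `[−1, 0)` in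
Pineau–Vicol's class (1.10) with the same constant. -/
def Sig.stub_pvClassOfProfile : Prop :=
  ∀ (α : ℝ) (V : E3 → E3) (Q : E3 → ℝ), ContDiff ℝ ∞ V → ContDiff ℝ ∞ Q → VectorCalculus.IsDivFree V →
    (∀ y, α • (rotGen (V y) - fderiv ℝ V y (rotGen y)) + (1 / 2 : ℝ) • V y + (1 / 2 : ℝ) • fderiv ℝ V y y
        - (Δ V) y + fderiv ℝ V y (V y) + gradient Q y = 0) →
    ∀ K : ℝ, (∀ y, ‖V y‖ ≤ K / (‖y‖ + 1)) →
    ∃ p : ℝ → E3 → ℝ, IsClassicalNSSolutionOn (Ico (-1) 0) 1 0 (pvAnsatz α (fun y _ => V y)) p ∧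
      ∀ t ∈ Ico (-1 : ℝ) 0, ∀ x : E3, ‖pvAnsatz α (fun y _ => V y) t x‖ ≤ K / (‖x‖ + Real.sqrt (-t))

/-- Statement of stub 2d `stub_windowLiouville`: WINDOW LIOUVILLE for Type-I rotated self-similar solitons of
Pineau–Vicol's class — VERBATIM the registered open stub B5b of crux `Target` (stmt-NavierStokesRegularity-1217),
line `killing-twisted-bernoulli-solitons` (Pineau–Vicol Conj. 1.1 on a compact window of rotation rates, with the
landed conjugate density and soliton laws available as hypotheses). -/
def Sig.stub_windowLiouville : Prop :=
  ∀ C₀ : ℝ, 0 < C₀ → ∀ a₀ A₀ : ℝ, 0 < a₀ → a₀ ≤ A₀ → ∀ α : ℝ, a₀ ≤ |α| → |α| ≤ A₀ → ∀ (u : ℝ → EuclideanSpace ℝ (Fin 3) → EuclideanSpace ℝ (Fin 3)) (p : ℝ → EuclideanSpace ℝ (Fin 3) → ℝ) (U : EuclideanSpace ℝ (Fin 3) → EuclideanSpace ℝ (Fin 3)) (m : EuclideanSpace ℝ (Fin 3) → ℝ) (c M₁ : ℝ), Literature.Analysis.FluidPDE.IsClassicalNSSolutionOn (Set.Ico (-1)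 0) 1 0 u p → (∀ t ∈ Set.Ico (-1 : ℝ) 0, ∀ x : EuclideanSpace ℝ (Fin 3), ‖u t x‖ ≤ C₀ / (‖x‖ + Real.sqrt (-t))) → ContDiff ℝ 2 U → (∀ t ∈ Set.Ico (-1 : ℝ) 0, ∀ x : EuclideanSpace ℝ (Fin 3), u t x = Literature.Analysis.FluidPDE.pvAnsatz α (fun y _ => U y) t x) → 0 < c → 0 < M₁ → (ContDiff ℝ 2 m ∧ (∀ y, 0 < m y) ∧ (∫ y, m y = 1) ∧ (∀ y, c * Real.exp (-(7 / 16 : ℝ) * ‖y‖ ^ 2) ≤ m y) ∧ (∀ y, m y ≤ M₁ * Real.exp (-(1 / 16 : ℝ) * ‖y‖ ^ 2)) ∧ (∃ M₂ : ℝ, ∀ y, ‖fderiv ℝ m y‖ ≤ M₂ * Real.exp (-(1 / 32 : ℝ) * ‖y‖ ^ 2)) ∧ (∀ y, Laplacian.laplacian m y + Literature.Analysis.FluidPDE.VectorCalculus.divergence (fun z => m z • (U z + (1 / 2 : ℝ) • z - α • Literature.Analysis.FluidPDE.rotGen z)) y = 0)) → (∫ y, ‖Literature.Analysis.FluidPDE.curl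 U y‖ ^ 2 * m y ≤ 4 * α ^ 2) → (∫ y, ‖Literature.Analysis.FluidPDE.curl U y‖ ^ 2 * m y = 2 * α * ∫ y, (Literature.Analysis.FluidPDE.curl U y) 2 * m y) → U = 0

/-! ## Stub 1 — LANDED (p146308, `Theorems/ExtremalTypeIConstantSpiralScalingLiouvilleStubRssProfileSystem.lean`) -/

/-- **Stub 1 — the rotated Leray profile system in the gauge (Pineau–Vicol (1.8) with a matrix rate).** If
`u ∈ A_C` is annihilated on `t < 0` by the spiral-scaling generator about the space–time origin,
`∇u·(x + Ax) + u + 2t∂ₜu − Au = 0`, then the slice `U = u(−1, ·)` solves, for some `C¹` pressure profile `P`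
(the KNSS pressure at `t = −1`), `−ΔU + ½U + ½∇U·(y + Ay) − ½AU + (U·∇)U + ∇P = 0` pointwise on `ℝ³`
(the generator gives `∂ₜu(−1) = ½(∇U·(y + Ay) + U − AU)`, the classical Navier–Stokes equation of the gauge class
gives `∂ₜu = Δu − (u·∇)u − ∇p`). -/
theorem stub_rssProfileSystem :
    ∀ (C : ℝ) (u : ℝ → E3 → E3), IsTypeIAncientMild C u →
      ∀ A : E3 →L[ℝ] E3,
        (∀ t < 0, ∀ x, fderiv ℝ (u t) x (x + A x) + u t x + (2 * t) • timeDeriv u t x - A (u t x) = 0) →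
        ∃ P : E3 → ℝ, ContDiff ℝ 1 P ∧
          ∀ y, -((Δ (u (-1))) y) + (1 / 2 : ℝ) • u (-1) y + (1 / 2 : ℝ) • fderiv ℝ (u (-1)) y (y + A y)
            - (1 / 2 : ℝ) • A (u (-1) y) + convect (u (-1)) (u (-1)) y + gradient P y = 0 :=
  -- LANDED (p146308): the registered stub, proved in the tree under `Theorems`
  Summit.NavierStokesRegularity.NavierStokesRegularity.Theorems.SpiralScalingLiouville.Birth.stub_rssProfileSystem

/-! ## Stubs 2a–2c — LANDED (wave 2 of lead c1); stub 2d — the only `sorry` of the file -/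

/-- **Stub 2a — the rate-zero leaf (Tsai 1998 Thm 1, `q = ∞`, plus decay; LANDED p150931).** A smooth
divergence-free solution `(U, P)` of LERAY's profile equation `−ΔU + ½U + ½(y·∇)U + (U·∇)U + ∇P = 0` (`P ∈ C¹`)
with `‖U(y)‖ ≤ K/(‖y‖ + 1)` vanishes: `IsLerayProfile 1 ½ U P`, so `U` is constant by the tree's
`IsLerayProfile.exists_eq_const_of_bounded`, and a constant with that decay is `0`. -/
theorem stub_rotatedProfileLiouvilleRateZero :
    ∀ (U : E3 → E3) (P : E3 → ℝ), ContDiff ℝ ∞ U → ContDiff ℝ 1 P →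
      VectorCalculus.IsDivFree U →
      (∀ y, -((Δ U) y) + (1 / 2 : ℝ) • U y + (1 / 2 : ℝ) • fderiv ℝ U y y + convect U U y + gradient P y = 0) →
      (∃ K : ℝ, ∀ y, ‖U y‖ ≤ K / (‖y‖ + 1)) →
      U = 0 :=
  -- LANDED (p150931): the registered stub, proved in the tree under `Theorems`
  Summit.NavierStokesRegularity.NavierStokesRegularity.Theorems.SpiralScalingLiouville.Birth.stub_rotatedProfileLiouvilleRateZero

/-- **Stub 2b — axis normal form of the profile system (LANDED p149847).** For a NONZERO skew rate `A`, there are a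
linear isometry `L` of `ℝ³` and `α ≠ 0` with `L A L⁻¹ = −2α J` (`J = rotGen = e₃ × ·`; tree:
`exists_conj_eq_smul_rotGen`), and the conjugate pair `V = L ∘ U ∘ L⁻¹`, `Q = P ∘ L⁻¹` is smooth (the pressure is
upgraded from `C¹` to `C^∞` through the equation, `∇P` being a smooth expression in `U`), divergence free, keeps the
decay constant, and solves Pineau–Vicol's profile system (1.8a)
`α(JV − DV[Jy]) + ½V + ½DV[y] − ΔV + DV[V] + ∇Q = 0` (every term is `L`-covariant; tree: `IsometryInvariance`). -/
theorem stub_profileAxisNormalForm :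
    ∀ (A : E3 →L[ℝ] E3), (∀ x, inner ℝ (A x) x = 0) → A ≠ 0 →
      ∀ (U : E3 → E3) (P : E3 → ℝ), ContDiff ℝ ∞ U → ContDiff ℝ 1 P →
        VectorCalculus.IsDivFree U →
        (∀ y, -((Δ U) y) + (1 / 2 : ℝ) • U y + (1 / 2 : ℝ) • fderiv ℝ U y (y + A y)
            - (1 / 2 : ℝ) • A (U y) + convect U U y + gradient P y = 0) →
        ∀ K : ℝ, (∀ y, ‖U y‖ ≤ K / (‖y‖ + 1)) →
        ∃ (L : E3 ≃ₗᵢ[ℝ] E3) (α : ℝ) (V : E3 → E3) (Q : E3 → ℝ), α ≠ 0 ∧ ContDiff ℝ ∞ V ∧ ContDiff ℝ ∞ Q ∧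
          VectorCalculus.IsDivFree V ∧
          (∀ y, α • (rotGen (V y) - fderiv ℝ V y (rotGen y)) + (1 / 2 : ℝ) • V y + (1 / 2 : ℝ) • fderiv ℝ V y y
              - (Δ V) y + fderiv ℝ V y (V y) + gradient Q y = 0) ∧
          (∀ y, ‖V y‖ ≤ K / (‖y‖ + 1)) ∧ (∀ y, V y = L (U (L.symm y))) :=
  -- LANDED (p149847): the registered stub, proved in the tree under `Theorems`
  Summit.NavierStokesRegularity.NavierStokesRegularity.Theorems.SpiralScalingLiouville.Birth.stub_profileAxisNormalForm

/-- **Stub 2c — Pineau–Vicol's class from a profile (LANDED p149921).** A smooth divergence-free solution `(V, Q)` of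
the profile system (1.8a) with `‖V(y)‖ ≤ K/(‖y‖ + 1)` generates through the ansatz (1.7) `u = pvAnsatz α V` a classical
Navier–Stokes solution on the time set `[−1, 0)` (tree: `classicalOfProfile_isBackwardLeraySolutionOn`,
`isClassicalNSSolutionOn_Iio_ofLerayOrbit_iff`, restriction `IsClassicalNSSolutionOn.mono`) obeying the Type-I bound
(1.10) `‖u(t,x)‖ ≤ K/(‖x‖ + √(−t))` (tree pattern: `PineauVicol2026.typeI_of_norm_profile_le`). -/
theorem stub_pvClassOfProfile :
    ∀ (α : ℝ) (V : E3 → E3) (Q : E3 → ℝ), ContDiff ℝ ∞ V → ContDiff ℝ ∞ Q → VectorCalculus.IsDivFree V →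
      (∀ y, α • (rotGen (V y) - fderiv ℝ V y (rotGen y)) + (1 / 2 : ℝ) • V y + (1 / 2 : ℝ) • fderiv ℝ V y y
          - (Δ V) y + fderiv ℝ V y (V y) + gradient Q y = 0) →
      ∀ K : ℝ, (∀ y, ‖V y‖ ≤ K / (‖y‖ + 1)) →
      ∃ p : ℝ → E3 → ℝ, IsClassicalNSSolutionOn (Ico (-1) 0) 1 0 (pvAnsatz α (fun y _ => V y)) p ∧
        ∀ t ∈ Ico (-1 : ℝ) 0, ∀ x : E3, ‖pvAnsatz α (fun y _ => V y) t x‖ ≤ K / (‖x‖ + Real.sqrt (-t)) :=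
  -- LANDED (p149921): the registered stub, proved in the tree under `Theorems`
  Summit.NavierStokesRegularity.NavierStokesRegularity.Theorems.SpiralScalingLiouville.Birth.stub_pvClassOfProfile

/-- **Stub 2d — WINDOW LIOUVILLE (the open core; XL, OPEN MATHEMATICS).** VERBATIM the registered stub B5b
`stub_windowLiouville` of crux `Target` (stmt-NavierStokesRegularity-1217), line `killing-twisted-bernoulli-solitons`:
for every Type-I constant `C₀ > 0` and compact window `0 < a₀ ≤ |α| ≤ A₀`, a classical Type-I rotated self-similar
solution of Pineau–Vicol's class on `[−1, 0)` with `C²` profile `U` and rate in the window, equipped with a rotating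
conjugate density `m` (Gaussian two-sided bounds, gradient bound, `Δm + ∇·(m(U + ½y − αJy)) = 0`) obeying the soliton
law `∫|curl U|²m ≤ 4α²` and identity `∫|curl U|²m = 2α∫(curl U)₂m`, is trivial. With the tree's Thm 1.4
(`pineauVicol2026_rss_liouville_holds`) and the landed stubs B1–B4 of that line this is equivalent to Pineau–Vicol's
Conjecture 1.1 for ALL `α` (`rssLiouville_of_windowLiouville`), to `SymmetricLiouville` (stmt-4053,
`solitonBridge_windowLiouville_iff_symmetricLiouville`) and hence (`spiralScalingLiouville_iff_symmetricLiouville`) to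
this crux. OPEN on the window `α ≈ 1` (Pineau–Vicol p. 4); one proof closes cruxes 1217-B5b, 4053, 8216 at once. -/
theorem stub_windowLiouville :
    ∀ C₀ : ℝ, 0 < C₀ → ∀ a₀ A₀ : ℝ, 0 < a₀ → a₀ ≤ A₀ → ∀ α : ℝ, a₀ ≤ |α| → |α| ≤ A₀ → ∀ (u : ℝ → EuclideanSpace ℝ (Fin 3) → EuclideanSpace ℝ (Fin 3)) (p : ℝ → EuclideanSpace ℝ (Fin 3) → ℝ) (U : EuclideanSpace ℝ (Fin 3) → EuclideanSpace ℝ (Fin 3)) (m : EuclideanSpace ℝ (Fin 3) → ℝ) (c M₁ : ℝ), Literature.Analysis.FluidPDE.IsClassicalNSSolutionOn (Set.Ico (-1) 0) 1 0 u p → (∀ t ∈ Set.Ico (-1 : ℝ) 0, ∀ x : EuclideanSpace ℝ (Fin 3), ‖u t x‖ ≤ C₀ / (‖x‖ + Real.sqrt (-t))) → ContDiff ℝ 2 U → (∀ t ∈ Set.Ico (-1 : ℝ) 0, ∀ x : EuclideanSpace ℝ (Fin 3), u t x = Literature.Analysis.FluidPDE.pvAnsatz α (fun y _ => U y) t x)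 → 0 < c → 0 < M₁ → (ContDiff ℝ 2 m ∧ (∀ y, 0 < m y) ∧ (∫ y, m y = 1) ∧ (∀ y, c * Real.exp (-(7 / 16 : ℝ) * ‖y‖ ^ 2) ≤ m y) ∧ (∀ y, m y ≤ M₁ * Real.exp (-(1 / 16 : ℝ) * ‖y‖ ^ 2)) ∧ (∃ M₂ : ℝ, ∀ y, ‖fderiv ℝ m y‖ ≤ M₂ * Real.exp (-(1 / 32 : ℝ) * ‖y‖ ^ 2)) ∧ (∀ y, Laplacian.laplacian m y + Literature.Analysis.FluidPDE.VectorCalculus.divergence (fun z => m z • (U z + (1 / 2 : ℝ) • z - α • Literature.Analysis.FluidPDE.rotGen z)) y = 0)) → (∫ y, ‖Literature.Analysis.FluidPDE.curl U y‖ ^ 2 * m y ≤ 4 * α ^ 2) → (∫ y, ‖Literature.Analysis.FluidPDE.curl U y‖ ^ 2 * m y = 2 * α * ∫ y, (Literature.Analysis.FluidPDE.curl U y) 2 * m y) → U = 0 := by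
  sorry

/-! ## Stub 2 from its parts (sorry-free composition) -/

/-- **The rotated core (`A ≠ 0`) of stub 2 from stubs 2b, 2c, 2d and the tree.** Conjugate to Pineau–Vicol's form
(2b); if the decay constant is `≤ 0` the profile vanishes outright; otherwise the profile generates a Type-I RSS
solution of Pineau–Vicol's class (2c), which is trivial by Liouville for ALL rates
(`rssLiouville_of_windowLiouville` = Thm 1.4 off the window + B2–B4 for `4α² ≤ ε₀` + the window stub 2d); undo the
conjugation. -/
theorem rotatedProfileLiouvilleCore_of (hB : Sig.stub_profileAxisNormalForm) (hC : Sig.stub_pvClassOfProfile)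
    (hD : Sig.stub_windowLiouville) :
    ∀ (A : E3 →L[ℝ] E3), (∀ x, inner ℝ (A x) x = 0) → A ≠ 0 →
      ∀ (U : E3 → E3) (P : E3 → ℝ), ContDiff ℝ ∞ U → ContDiff ℝ 1 P →
        VectorCalculus.IsDivFree U →
        (∀ y, -((Δ U) y) + (1 / 2 : ℝ) • U y + (1 / 2 : ℝ) • fderiv ℝ U y (y + A y)
            - (1 / 2 : ℝ) • A (U y) + convect U U y + gradient P y = 0) →
        (∃ K : ℝ, ∀ y, ‖U y‖ ≤ K / (‖y‖ + 1)) →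
        U = 0 := by
  intro A hA hA0 U P hU hP hdiv heq hdec
  obtain ⟨K, hK⟩ := hdec
  obtain ⟨L, α, V, Q, _hα, hV, hQ, hVdiv, hVeq, hVK, hVU⟩ := hB A hA hA0 U P hU hP hdiv heq K hK
  -- the conjugate profile vanishes
  have hV0 : V = 0 := by
    rcases le_or_gt K 0 with hK0 | hK0
    · funext y
      have h1 : ‖V y‖ ≤ 0 := (hVK y).trans (div_nonpos_of_nonpos_of_nonneg hK0 (by positivity))
      exact norm_le_zero_iff.1 h1
    · obtain ⟨p, hns, hI⟩ := hC α V Q hV hQ hVdiv hVeq K hVK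
      exact Summit.NavierStokesRegularity.NavierStokesRegularity.Theorems.rssLiouville_of_windowLiouville hD K hK0 α
        (pvAnsatz α (fun y _ => V y)) p V hns hI
        (contDiff_infty.1 hV 2) (fun _ _ _ => rfl)
  -- undo the conjugation
  funext z
  have h1 := hVU (L z)
  rw [hV0, Pi.zero_apply, LinearIsometryEquiv.symm_apply_apply] at h1
  have h2 : U z = L.symm 0 := by rw [h1, LinearIsometryEquiv.symm_apply_apply]
  rw [h2, map_zero, Pi.zero_apply]

/-- **Stub 2 (the registered profile Liouville statement of the birth skeleton) from its parts**: `A = 0` is the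
rate-zero leaf 2a (Tsai); `A ≠ 0` is `rotatedProfileLiouvilleCore_of`. -/
theorem rotatedProfileLiouville_of (hZ : Sig.stub_rotatedProfileLiouvilleRateZero)
    (hB : Sig.stub_profileAxisNormalForm) (hC : Sig.stub_pvClassOfProfile) (hD : Sig.stub_windowLiouville) :
    Sig.stub_rotatedProfileLiouville := by
  intro A hA U P hU hP hdiv heq hdec
  rcases eq_or_ne A 0 with rfl | hA0
  · refine hZ U P hU hP hdiv (fun y => ?_) hdec
    simpa only [zero_apply, add_zero, smul_zero, sub_zero] using heq y
  · exact rotatedProfileLiouvilleCore_of hB hC hD A hA hA0 U P hU hP hdiv heq hdec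

/-- Stub 2 under its registered name, now DERIVED from stubs 2a–2d (no `sorry` of its own). -/
theorem stub_rotatedProfileLiouville :
    ∀ (A : E3 →L[ℝ] E3), (∀ x, inner ℝ (A x) x = 0) →
      ∀ (U : E3 → E3) (P : E3 → ℝ), ContDiff ℝ ∞ U → ContDiff ℝ 1 P →
        VectorCalculus.IsDivFree U →
        (∀ y, -((Δ U) y) + (1 / 2 : ℝ) • U y + (1 / 2 : ℝ) • fderiv ℝ U y (y + A y)
            - (1 / 2 : ℝ) • A (U y) + convect U U y + gradient P y = 0) →
        (∃ K : ℝ, ∀ y, ‖U y‖ ≤ K / (‖y‖ + 1)) →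
        U = 0 :=
  rotatedProfileLiouville_of stub_rotatedProfileLiouvilleRateZero stub_profileAxisNormalForm stub_pvClassOfProfile
    stub_windowLiouville

/-! ## The composition (sorry-free): the stubs prove the crux BY NAME -/

/-- **The skeleton concludes the crux `SpiralScalingLiouville` (stmt-NavierStokesRegularity-8216) BY NAME** from
the single open stub 2d `stub_windowLiouville` (stubs 1, 2a, 2b, 2c landed; stub 2 derived by `rotatedProfileLiouville_of`): unfold the class, translate the spiral centre `c` (`c + Ac = −a`) to the origin, put the
translated field in Pineau–Vicol's class (tree: `rssFarFieldTypeIDecay`), read off the rotated profile system at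
`t = −1` (stub 1), kill the profile (stub 2), transport the vanishing slice to every `s < 0` along the integrated
spiral scaling (tree: `rss_identity_of_generator` with `e^ρ = (−s)^{-1/2}`), translate back. -/
theorem SpiralScalingLiouville_of :
    Sig.stub_windowLiouville →
    Summit.NavierStokesRegularity.NavierStokesRegularity.Theses.ExtremalTypeIConstant.SpiralScalingLiouville := by
  intro hD C u hu hsym t ht x
  -- stub 1 (LANDED, p146308) and stub 2 (derived from the LANDED stubs 2a–2c and the open stub 2d)
  have h1 : Sig.stub_rssProfileSystem :=
    Summit.NavierStokesRegularity.NavierStokesRegularity.Theorems.SpiralScalingLiouville.Birth.stub_rssProfileSystem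
  have h2 : Sig.stub_rotatedProfileLiouville := rotatedProfileLiouville_of
    Summit.NavierStokesRegularity.NavierStokesRegularity.Theorems.SpiralScalingLiouville.Birth.stub_rotatedProfileLiouvilleRateZero
    Summit.NavierStokesRegularity.NavierStokesRegularity.Theorems.SpiralScalingLiouville.Birth.stub_profileAxisNormalForm
    Summit.NavierStokesRegularity.NavierStokesRegularity.Theorems.SpiralScalingLiouville.Birth.stub_pvClassOfProfile hD
  obtain ⟨a, A, hA, hL⟩ := hsym
  have hcl : IsTypeIAncientMild C u := isTypeIAncientMild_iff.2 hu
  -- the spiral centre `c`: `c + A c = -a` (`1 + A` is invertible since `A` is skew)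
  obtain ⟨c, hc⟩ := exists_spiral_centre (σ := 1) one_ne_zero hA a
  rw [one_smul] at hc
  -- translate the centre to the origin: `v t y = u t (y + c)` is again in `A_C`
  have hv : IsTypeIAncientMild C (fun t x => u t (x + c)) := isTypeIAncientMild_comp_add_right hcl c
  -- and is annihilated by the generator in normal form
  have hLv : ∀ t < 0, ∀ x, fderiv ℝ (fun y => u t (y + c)) x (x + A x) + u t (x + c) +
      (2 * t) • timeDeriv (fun s y => u s (y + c)) t x - A (u t (x + c)) = 0 := by
    intro t ht x
    have key := hL t ht (x + c)
    have e1 : a + (x + c) + A (x + c) = x + A x := by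
      have h0 : c + A c + a = 0 := by rw [hc, neg_add_cancel]
      calc a + (x + c) + A (x + c) = x + A x + (c + A c + a) := by rw [map_add]; abel
        _ = x + A x := by rw [h0, add_zero]
    rw [e1] at key
    have e2 : fderiv ℝ (fun y => u t (y + c)) x = fderiv ℝ (u t) (x + c) := by
      rw [fderiv_comp_add_right]
    have e3 : timeDeriv (fun s y => u s (y + c)) t x = timeDeriv u t (x + c) := rfl
    rw [e2, e3]
    exact key
  -- it suffices to kill the translated field on the whole past
  suffices hzero : ∀ s < 0, ∀ y : E3, u s (y + c) = 0 by
    have key := hzero t ht (x - c)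
    simpa only [sub_add_cancel] using key
  -- Pineau–Vicol decay of the translated field (tree: far-field recentring + Oseen bootstrap B2)
  obtain ⟨K, hK⟩ := rssFarFieldTypeIDecay C (fun t x => u t (x + c)) hv A hA hLv
  -- stub 1: the rotated Leray profile system for the slice `U = v(-1, ·)`
  obtain ⟨P, hP, hPeq⟩ := h1 C (fun t x => u t (x + c)) hv A hLv
  -- the profile is smooth, divergence free, and decays at the Type-I rate
  have hUs : ContDiff ℝ ∞ (fun y => u (-1) (y + c)) := hv.contDiff_slice (by norm_num)
  have hUd : VectorCalculus.IsDivFree (fun y => u (-1) (y + c)) := hv.isDivFree (by norm_num)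
  have hdec : ∃ K : ℝ, ∀ y : E3, ‖u (-1) (y + c)‖ ≤ K / (‖y‖ + 1) := by
    refine ⟨K, fun y => ?_⟩
    have h := hK (-1) (by norm_num) y
    rw [neg_neg, Real.sqrt_one] at h
    exact h
  -- stub 2: the profile vanishes
  have hV0 : (fun y => u (-1) (y + c)) = 0 :=
    h2 A hA (fun y => u (-1) (y + c)) P hUs hP hUd hPeq hdec
  have h0 : ∀ z : E3, u (-1) (z + c) = 0 := fun z => by
    have hz := congr_fun hV0 z
    simpa using hz
  -- transport from `t = -1` to every `s < 0` along the integrated spiral scaling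
  intro s hs y
  have hns : 0 < -s := neg_pos.2 hs
  have hr : 0 < (Real.sqrt (-s))⁻¹ := inv_pos.2 (Real.sqrt_pos.2 hns)
  have key := rss_identity_of_generator hv hLv (Real.log (Real.sqrt (-s))⁻¹) hs y
  have hct : (Real.sqrt (-s))⁻¹ ^ 2 * s = -1 := by
    rw [inv_pow, Real.sq_sqrt hns.le, inv_mul_eq_div, div_neg, div_self hs.ne]
  rw [Real.exp_log hr, hct] at key
  beta_reduce at key
  rw [h0] at key
  simpa using key

/-- The crux itself from the registered stubs (only `stub_*` carry `sorry`). -/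
theorem SpiralScalingLiouville_proof :
    Summit.NavierStokesRegularity.NavierStokesRegularity.Theses.ExtremalTypeIConstant.SpiralScalingLiouville :=
  SpiralScalingLiouville_of stub_windowLiouville

end Summit.NavierStokesRegularity.NavierStokesRegularity.Cruxes.SpiralScalingLiouville.Birth

end
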